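import Summits.Ventures.CertifiedQuantumChemistry.Rows.ExactOrbitalRotation
import Summits.Ventures.CertifiedQuantumChemistry.Rows.LevelShiftGapRows
import Mathlib.LinearAlgebra.Matrix.NonsingularInverse
import HarnessLib

/-!
# Ventures/CertifiedQuantumChemistry — Rows/ExactRotationDevice.lean: the «exact rotated table» certificate DEVICE — (E2a) the CAYLEY
# rotation is an exact orbital rotation, (E2b) the denominator bookkeeping of the exact 4-index transform, (E2c) a Temple LOWER row
# certified on the ROTATED file is a lower row of the census file and brackets with its U rows (director-chem P13 (3), 2026-08-29)

HONEST FRAMING (verbatim): certified bounds for a stated model Hamiltonian in a stated basis; not a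
claim about the real molecule or material beyond that model. This file certifies NO number: it states (and,
where the proof is a few lines of algebra over the tree's objects, proves) the three STATEMENT SHAPES the
wave-4 LINE #1 «M3 × M5 — relaxation in the rotated frame» will instantiate at STEP-2 (director-chem P13 (3):
«(E2a) an exactly orthogonal rational rotation u (Cayley of a rational skew matrix) and its integer scaling,
(E2b) the exact 4-index transform F″ = F∘u as an integer FCIDUMP with its denominator bookkeeping, (E2c) the
invariance statement E₀(F″; N_α, N_β) = E₀(F; N_α, N_β) that lets a Temple lower bound certified on F″ be
tabled against U-rows certified on F — statement shapes only; … proofs and engines are the LINE's later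
business»). Objects: `Model.IsExactOrbitalRotation u := uᵀu = 1` (over ℚ), `Model.rotate u F` (HJO (3.2.1)),
`Model.energy_rotate` / `lowerRow_rotate_iff` (Rows/ExactOrbitalRotation.lean, in tree — (E2c) IS that lemma; here
only the cross-file BRACKET composition is added).

WHAT IS TYPED (chem-type-07 B8-1, gen 12; zero compute): §1 (E2a) `Model.cayley A := (1 − A)(1 + A)⁻¹` and
`Model.isExactOrbitalRotation_cayley : Aᵀ = −A → IsUnit (1 + A).det → IsExactOrbitalRotation (cayley A)` (PROVED:
`(1 + A)ᵀ = 1 − A`, the two factors commute, `Matrix.nonsing_inv` algebra) + the scaling fact `(c • u)` is NOT a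
rotation but `rotate (c • u) F` rescales the tables by `c²` / `c⁴` (E2b, `Model.rotate_smul_h` / `_eri`: the
denominator bookkeeping «u = U/q with U integral ⇒ q²·D·h″ and q⁴·D·(pq|rs)″ are integers when D·h, D·(pq|rs) are»,
stated as the exact identities a reader checks); §2 (E2c) `lowerRow_of_rotated` / `bracket_of_rotated_lower` — a
`LowerRow (rotate u F) a b lo` (e.g. a Temple row certified on the EXACT rotated file F″ = rotate u F) IS
`LowerRow F a b lo` and brackets with any `UpperRow F a b hi` of the census file. No rounding, no ε: the device of P13
is the EXACT transform (integer FCIDUMP), not the 25-decimal re-rounding of LINE 87f6ae85 (whose op-norm transport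
(E2)-Lipschitz stays un-typed per chem-lead A366).
WHAT THIS IS NOT: not a certificate, not a row, not an engine; nothing asserted about any file; the kernel-side
cost of DECIDING `uᵀu = 1` on a literal 24 × 24 rational `u` is not addressed here (the Cayley lemma replaces it
by `Aᵀ = −A` — decidable entrywise — plus ONE determinant non-vanishing, itself certifiable by exhibiting the
rational inverse `V` with `(1 + A)·V = 1`, see `Model.isExactOrbitalRotation_cayley_of_inverse`).
-/

noncomputable section

namespace Summit.Ventures.CertifiedQuantumChemistry

open Matrix Finset

namespace Model

variable {k : ℕ}

/-! ## §1 (E2a) The Cayley rotation and (E2b) the scaling bookkeeping -/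

/-- **The CAYLEY transform** of a square rational matrix: `cayley A := (1 − A)·(1 + A)⁻¹` (`⁻¹` = `Matrix.nonsing_inv`,
the adjugate formula; it IS the inverse when `det (1 + A) ≠ 0`). For skew `A` this is an exactly orthogonal rational
matrix — the producer's way to an exact frame `u` near a float orthogonal `U♭` (A := round((1 − U♭)(1 + U♭)⁻¹) skew).
[cite: HelgakerJorgensenOlsen2000, eq. (3.1.23)] -/
def cayley (A : Matrix (Fin k) (Fin k) ℚ) : Matrix (Fin k) (Fin k) ℚ := (1 - A) * (1 + A)⁻¹

/-- **(E2a) THE CAYLEY ROTATION IS AN EXACT ORBITAL ROTATION**: for a SKEW rational matrix `A` (`Aᵀ = −A`) with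
`det (1 + A) ≠ 0` (always true over ℝ for skew `A`; over ℚ the producer exhibits it), `u := (1 − A)(1 + A)⁻¹`
satisfies `uᵀ·u = 1` EXACTLY. Proof: `uᵀ = ((1 + A)⁻¹)ᵀ(1 − A)ᵀ = (1 − A)⁻¹(1 + A)` (transpose of skew), and
`(1 + A)(1 − A) = (1 − A)(1 + A)`. [cite: HelgakerJorgensenOlsen2000, eq. (3.1.23)] -/
theorem isExactOrbitalRotation_cayley {A : Matrix (Fin k) (Fin k) ℚ} (hA : Aᵀ = -A)
    (hdet : IsUnit (1 + A).det) : IsExactOrbitalRotation (cayley A) := by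
  unfold IsExactOrbitalRotation cayley
  have h1T : (1 + A)ᵀ = 1 - A := by rw [transpose_add, transpose_one, hA, sub_eq_add_neg]
  have h2T : (1 - A)ᵀ = 1 + A := by rw [transpose_sub, transpose_one, hA, sub_neg_eq_add]
  have hdet' : IsUnit (1 - A).det := by rw [← h1T, det_transpose]; exact hdet
  have hcomm : (1 + A) * (1 - A) = (1 - A) * (1 + A) := by noncomm_ring
  rw [transpose_mul, transpose_nonsing_inv, h1T, h2T]
  -- (1 - A)⁻¹ * (1 + A) * ((1 - A) * (1 + A)⁻¹) = 1
  calc (1 - A)⁻¹ * (1 + A) * ((1 - A) * (1 + A)⁻¹)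
      = (1 - A)⁻¹ * ((1 + A) * (1 - A)) * (1 + A)⁻¹ := by noncomm_ring
    _ = (1 - A)⁻¹ * ((1 - A) * (1 + A)) * (1 + A)⁻¹ := by rw [hcomm]
    _ = ((1 - A)⁻¹ * (1 - A)) * ((1 + A) * (1 + A)⁻¹) := by noncomm_ring
    _ = 1 := by rw [nonsing_inv_mul _ hdet', mul_nonsing_inv _ hdet, one_mul]

/-- **(E2a), CERTIFICATE FORM**: the producer ships the rational inverse `V` of `1 + A` explicitly (`(1 + A)·V = 1`,
decidable entrywise on literals); then `det (1 + A)` is a unit and `u := (1 − A)·V` equals `cayley A` and is an exact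
orbital rotation — no determinant and no `⁻¹` has to be evaluated by the kernel. [cite: HelgakerJorgensenOlsen2000, eq. (3.1.23)] -/
theorem isExactOrbitalRotation_cayley_of_inverse {A V : Matrix (Fin k) (Fin k) ℚ} (hA : Aᵀ = -A)
    (hV : (1 + A) * V = 1) : IsExactOrbitalRotation ((1 - A) * V) := by
  have hdet : IsUnit (1 + A).det := Matrix.isUnit_det_of_right_inverse hV
  have hVinv : V = (1 + A)⁻¹ := (Matrix.inv_eq_right_inv hV).symm
  rw [hVinv]
  exact isExactOrbitalRotation_cayley hA hdet

/-- **(E2b) DENOMINATOR BOOKKEEPING, one-electron table**: rotating by a SCALED matrix `c • u` rescales `h″` by `c²`: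
`(rotate (c • u) F).h a b = c² · (rotate u F).h a b`. With `u = U/q` (`U` integral, `q ∈ ℕ`) and `D·h` integral this says
`q²·D·h″` is an integer table — the FCIDUMP the producer writes carries the common denominator `q²·D` on its one-body lines. -/
theorem rotate_smul_h (c : ℚ) (u : Matrix (Fin k) (Fin k) ℚ) (F : Model k) (a b : Fin k) :
    (rotate (c • u) F).h a b = c ^ 2 * (rotate u F).h a b := by
  simp only [rotate_h, Matrix.smul_apply, smul_eq_mul, Finset.mul_sum]
  refine Finset.sum_congr rfl fun p _ => Finset.sum_congr rfl fun q _ => ?_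
  ring

/-- **(E2b) DENOMINATOR BOOKKEEPING, two-electron table**: `(rotate (c • u) F).eri a b c d = c⁴ · (rotate u F).eri a b c d`
— with `u = U/q` and `D·(pq|rs)` integral, `q⁴·D·(ab|cd)″` is an integer table (the two-body lines' common denominator);
`E_core″ = E_core` (`rotate_ecore`). -/
theorem rotate_smul_eri (c : ℚ) (u : Matrix (Fin k) (Fin k) ℚ) (F : Model k) (a b c' d : Fin k) :
    (rotate (c • u) F).eri a b c' d = c ^ 4 * (rotate u F).eri a b c' d := by
  simp only [rotate_eri, Matrix.smul_apply, smul_eq_mul, Finset.mul_sum]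
  refine Finset.sum_congr rfl fun p _ => Finset.sum_congr rfl fun q _ =>
    Finset.sum_congr rfl fun r _ => Finset.sum_congr rfl fun s _ => ?_
  ring

end Model

/-! ## §2 (E2c) A lower row certified on the exact rotated file is a lower row of the census file -/

variable {k : ℕ} {u : Matrix (Fin k) (Fin k) ℚ}

/-- **(E2c) TRANSPORT OF A LOWER ROW FROM THE ROTATED FILE** (`Model.energy_rotate`: `E₀(rotate u F; a, b) = E₀(F; a, b)`):
a `LowerRow (rotate u F) a b lo` — e.g. a Temple lower certified from exact integer moments of a trial vector expressed in the
rotated orbital frame, ON the exact rotated integer FCIDUMP F″ = rotate u F — IS `LowerRow F a b lo` on the census key of `F`.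
[cite: HelgakerJorgensenOlsen2000, eq. (3.2.1)] -/
theorem lowerRow_of_rotated (hu : Model.IsExactOrbitalRotation u) {F : Model k} {a b : ℕ} {lo : ℚ}
    (h : LowerRow (Model.rotate u F) a b lo) : LowerRow F a b lo :=
  (lowerRow_rotate_iff hu F a b lo).1 h

/-- **(E2c) THE DEVICE'S ROW: a lower half certified on F″ = rotate u F brackets with an upper half certified on F** —
`LowerRow (rotate u F) a b lo` and `UpperRow F a b hi` give `Bracket F a b lo hi` (the table's two halves may live on
different but exactly unitarily-equivalent files). [cite: HelgakerJorgensenOlsen2000, eq. (3.2.1)] -/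
theorem bracket_of_rotated_lower (hu : Model.IsExactOrbitalRotation u) {F : Model k} {a b : ℕ} {lo hi : ℚ}
    (hL : LowerRow (Model.rotate u F) a b lo) (hU : UpperRow F a b hi) : Bracket F a b lo hi :=
  ⟨lowerRow_of_rotated hu hL, hU⟩

/-- The symmetric statement for a GAP LEG: a level-shift lower row is certified where it is cheapest; if the shifted file of
the ROTATED model `rotate u F + λ·W` carries `LowerRow … ℓ` and the weight file is `u`-INVARIANT (`rotate u W = W`, e.g. a
block-diagonal frame that fixes the reference orbital set J of `Model.diagWeight 1_J μ`), then the census model's shifted file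
`F + λ·W` carries the same row (`rotate` is linear in the tables: `rotate u (lincomb α β F W) = lincomb α β (rotate u F) (rotate u W)`).
[cite: HelgakerJorgensenOlsen2000, eq. (3.2.1)] -/
theorem Model.rotate_lincomb (u : Matrix (Fin k) (Fin k) ℚ) (α β : ℚ) (F W : Model k) :
    Model.rotate u (Model.lincomb α β F W) = Model.lincomb α β (Model.rotate u F) (Model.rotate u W) :=
  Model.ext' (funext fun a => funext fun b => by
      simp only [Model.rotate_h, Model.lincomb_h, Finset.sum_add_distrib, Finset.mul_sum, mul_add]
      congr 1 <;> (refine Finset.sum_congr rfl fun p _ => Finset.sum_congr rfl fun q _ => ?_) <;> ring)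
    (funext fun a => funext fun b => funext fun c => funext fun d => by
      simp only [Model.rotate_eri, Model.lincomb_eri, Finset.sum_add_distrib, Finset.mul_sum, mul_add]
      congr 1 <;> (refine Finset.sum_congr rfl fun p _ => Finset.sum_congr rfl fun q _ =>
        Finset.sum_congr rfl fun r _ => Finset.sum_congr rfl fun s _ => ?_) <;> ring)
    (by simp only [Model.rotate_ecore, Model.lincomb_ecore])


/-! ## §3 Frames that FIX a weight file: `rotate u (diagWeight w μ) = diagWeight w μ` for block-diagonal `u` (the «rotate u W = W» hypothesis of the β-leg transport) -/

/-- **A BLOCK-DIAGONAL exact rotation fixes the diagonal weight file** (discharges the `rotate u W = W` hypothesis of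
`lowerRow_levelShift_of_exactRotation_round`, Rows/TableDistanceTransport.lean): if `u` is an exact orbital rotation whose nonzero
entries only connect orbitals of EQUAL weight (`u p a ≠ 0 → w p = w a` — e.g. the split-natural-orbital frame `u_docc ⊕ 1_somo ⊕ u_virt`
against the door-M1 weights `w = 2·1_docc + 1·1_somo` of `e24AnionShiftW`, or any `u` preserving the reference set `J` of `diagWeight 1_J μ`),
then `rotate u (diagWeight w μ) = diagWeight w μ` EXACTLY: `h′_ab = Σ_p u_pa u_pb w_p = w_a·(uᵀu)_ab = w_a·δ_ab`, `eri′ = 0`, `E_core′ = −μ`.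
[cite: HelgakerJorgensenOlsen2000, eq. (3.2.1)] -/
theorem Model.rotate_diagWeight_of_block {u : Matrix (Fin k) (Fin k) ℚ} (hu : Model.IsExactOrbitalRotation u)
    {w : Fin k → ℚ} (hblk : ∀ p a, u p a ≠ 0 → w p = w a) (μ : ℚ) :
    Model.rotate u (Model.diagWeight w μ) = Model.diagWeight w μ := by
  refine Model.ext' (funext fun a => funext fun b => ?_) (funext fun a => funext fun b => funext fun c => funext fun d => ?_) rfl
  · -- one-electron table
    have huu : ∀ a b : Fin k, ∑ p, u p a * u p b = if a = b then 1 else 0 := by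
      intro a b
      have h := congrFun (congrFun hu a) b
      simpa [Matrix.mul_apply, Matrix.transpose_apply, Matrix.one_apply] using h
    simp only [Model.rotate_h, Model.diagWeight]
    calc ∑ p, ∑ q, u p a * u q b * (if p = q then w p else 0)
        = ∑ p, u p a * u p b * w p := by
          refine Finset.sum_congr rfl fun p _ => ?_
          rw [Finset.sum_eq_single p (fun q _ hq => by rw [if_neg (Ne.symm hq), mul_zero]) (fun h => (h (Finset.mem_univ p)).elim),
            if_pos rfl]
      _ = ∑ p, w a * (u p a * u p b) := by
          refine Finset.sum_congr rfl fun p _ => ?_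
          by_cases hp : u p a = 0
          · rw [hp]; ring
          · rw [hblk p a hp]; ring
      _ = w a * ∑ p, u p a * u p b := by rw [Finset.mul_sum]
      _ = if a = b then w a else 0 := by rw [huu]; split_ifs <;> ring
  · -- two-electron table
    simp only [Model.rotate_eri, Model.diagWeight, mul_zero, Finset.sum_const_zero]


end Summit.Ventures.CertifiedQuantumChemistry

end
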